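import Summits.BirchSwinnertonDyer.BirchSwinnertonDyer.Theorems.KimAtThreeShallowEqDeepRouteLeafOfPosition
import Summits.BirchSwinnertonDyer.BirchSwinnertonDyer.Theorems.KimAtThreeFineKatoTwoExpFinal
import Summits.BirchSwinnertonDyer.BirchSwinnertonDyer.Theorems.KimAtThreeShallowEqDeepOfPeriodPosition
import HarnessLib

/-!
# Route `KimAtThreeKolyvagin` (W2): cruxes 19599 / 19077 and the ROUTE LEAF `N11.KimAtThreeRankZeroPUB` BY NAME from the route leaves,
# cite facts, the Kato Literature fact and hKatoPosʷ ALONE — item 20398 discharged (cell `bsd-addord`, seat w2-acc3 gen 9;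
# helper, `--supports stmt-BirchSwinnertonDyer-20398`)

HONEST FRAMING.  Composition theorems only (no definition, no named fact, no instance, no `sorry`).  Every hypothesis is DISPLAYED:
the route leaves `SakamotoKolyvaginThree` / `RankEqAnalyticRankLeOne` / `PoitouTateSelmerDuality` / `CarayolLevelEqConductor` (items,
held PUB), the Literature cite facts (S5a) / (S5b-tower) / (P123) / (DR) and `Kato2004.exists_eulerSystem_definedExpStar_values`
(`def … : Prop`, D-0014), and w2-c4 gen 12's all-rows Kato-position package hKatoPosʷ (VERBATIM the section variable of
`KimAtThreeShallowEqDeepRouteLeafOfPosition`).  ALL CONDITIONAL; nothing is closed or booked; BSD is NOT proved by any of this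
(«closes rung W2» only modulo the displayed hypotheses — never summit credit).

WHAT.  w2-c4 gen 12's `KimAtThreeShallowEqDeepRouteLeafOfPosition` (p547009) put crux 19077 and the route leaf BY NAME on «4 leaves ∧
cites ∧ Kato Literature fact ∧ hKatoPosʷ ∧ item 20398», and `…NonAdditiveOfPosition` (p545308) put crux 19599 on «3 leaves ∧ cites ∧
hKatoPosʷ ∧ item 20398».  This seat's `KimAtThreeFineKatoTwoExpFinal.fineKatoTwoExpDefectThree_of_facts_of_katoPosW` (item 20398 BY
NAME ⟸ {S5a, S5b-tower, P123, DR} ∧ hKatoPosʷ) removes item 20398 from all three: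
* `shallowEqDeepOffKatoStratum_of_katoPos_of_cites'` — **crux 19599 BY NAME ⟸ 3 route leaves ∧ {S5a, S5b-tower, P123, DR} ∧ hKatoPosʷ**;
* `shallowEqDeepAtTorsionFree_of_katoPos_of_cites'` — **crux 19077 BY NAME ⟸ 4 route leaves ∧ {S5a, S5b-tower, P123, DR} ∧ hKatoPosʷ**;
* `kimAtThreeRankZeroPUB_of_katoPos_of_lit_of_cites'` — **the ROUTE LEAF `N11.KimAtThreeRankZeroPUB` BY NAME ⟸ 4 route leaves ∧
  {S5a, S5b-tower, P123, DR} ∧ `Kato2004.exists_eulerSystem_definedExpStar_values` ∧ hKatoPosʷ**.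
* §2 (the NAMED currency of w2-c4 gen 13, p552920/p554491): the same three end forms with hKatoPosʷ replaced by the ONE-TOKEN statement
  `KimAtThreeShallowEqDeepPositionDefs.KatoPeriodPositionAtThree` (via w2-c4's `katoPosW_of_periodPosition_of_facts`), plus
  `fineKatoTwoExpDefectThree_of_periodPosition_of_cites` (item 20398 BY NAME ⟸ 4 cites ∧ `KatoPeriodPositionAtThree`): the W2 ROUTE LEAF
  BY NAME ⟸ 4 route leaves ∧ {S5a, S5b-tower, P123, DR} ∧ Kato Literature fact ∧ `KatoPeriodPositionAtThree` — EVERY hypothesis a named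
  one-liner, item 20398 gone (`kimAtThreeRankZeroPUB_of_periodPosition_of_lit_of_cites'`).
READING (route card): the whole W2 route now rests on cite-only named statements plus ONE displayed non-cite statement, POS (the 3-adic
position of Kato's generator against the Néron/duality line, inside hKatoPosʷ / = `KatoPeriodPositionAtThree`; = kim3's 19560 residual on
the Kato stratum).  The Defs statement is referred to QUALIFIED here (w2-c4's NAMING HAZARD note, STATUS 2026-08-27T18:58Z).
Credit: w2-c4 g12 (the end forms), kim3 / w2-acc4 / w2-acc5 / w2-kport / w2-c2 / w2-c3 / n1011 (everything underneath).
References: [Kim2025RefinedTNC] Thm. 1.1/1.2; [Kato2004Asterisque] (8.1.3), 8.12, §9.4, 9.7, 6.6 (1), 13.3; [Kato1993LNM1553] II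
§1.2.4, 1.2.3, 1.3.5, 1.4.1; [BlochKato1990] §3; [Kim2022StructureSelmer] §3.2.3, Lemma 3.10, Thm. 3.13; [Sakamoto2024] Thm. 4.4;
[MazurRubin2004] Thm. 4.4.1, 5.2.12; [Carayol1986].
-/

set_option autoImplicit false

noncomputable section

-- the cell's Theorems namespace `Summit.BirchSwinnertonDyer.BirchSwinnertonDyer.…` repeats the summit name by design (D-0017)
set_option linter.dupNamespace false

open scoped Classical NumberField TensorProduct ContRepresentation Pointwise
open Field ValuativeRel Function IsDedekindDomain NumberField
open WeierstrassCurve Literature.NumberTheory.EllipticCurves Literature.NumberTheory.GaloisRepresentations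
  Literature.NumberTheory.GaloisRepresentations.DiscreteGaloisModule Literature.NumberTheory.GaloisCohomology
open Literature.NumberTheory.GaloisRepresentations.PeriodRingData Literature.NumberTheory.PAdicHodge Literature.NumberTheory.EllipticCurves.ModularForms Literature.NumberTheory.EllipticCurves.Rank1Residual
open Literature.NumberTheory.EllipticCurves.Kato2004 Literature.NumberTheory.EllipticCurves.Kato2004.EulerSystemValues
open Literature.NumberTheory.AdelicBaseChange Literature.NumberTheory.Automorphic
open Summit.BirchSwinnertonDyer.Rank1Residual.GaloisImage Summit.BirchSwinnertonDyer.Rank1Residual.Additive.LocalLog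
open Summit.BirchSwinnertonDyer.BirchSwinnertonDyer.Theorems
open Summit.BirchSwinnertonDyer.BirchSwinnertonDyer.Theorems.KimAtThreeFineKatoLevelCompat
open Summit.BirchSwinnertonDyer.BirchSwinnertonDyer.Theorems.KimAtThreeFineKatoPerFactorDefined
open Summit.BirchSwinnertonDyer.BirchSwinnertonDyer.Theorems.KimAtThreeFineKatoPerFactorDefinedTwist
open Summit.BirchSwinnertonDyer.BirchSwinnertonDyer.Theorems.KimAtThreeDeepLowerExpStarOmega
open Summit.BirchSwinnertonDyer.BirchSwinnertonDyer.Theorems.KimAtThreeDeepLowerExpStarOmegaPlace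
open Summit.BirchSwinnertonDyer.BirchSwinnertonDyer.Theorems.KimAtThreeFineKatoPerFactorPlaces
open Summit.BirchSwinnertonDyer.BirchSwinnertonDyer.Theorems.KimAtThreeDeepUpperExpStarFacts
open Summit.BirchSwinnertonDyer.Rank1Residual.GaloisImage.TameLevel (squarefree_cycLevel_zero)
open Summit.BirchSwinnertonDyer.BirchSwinnertonDyer.Theorems.KimAtThreeSemiLocalTraceDualCyc
open Summit.BirchSwinnertonDyer.BirchSwinnertonDyer.Theorems.KimAtThreeShallowEqDeepTraceDualLattice
open Summit.BirchSwinnertonDyer.BirchSwinnertonDyer.Theorems.KimAtThreeShallowEqDeepWildDifferentLocal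
open Summit.BirchSwinnertonDyer.BirchSwinnertonDyer.Theorems.KimAtThreeShallowEqDeepRiderOfWeightedCompat
open Summit.BirchSwinnertonDyer.BirchSwinnertonDyer.Theses.KimAtThreeKolyvagin
open Summit.BirchSwinnertonDyer.BirchSwinnertonDyer.Theorems.KimAtThreeShallowEqDeepNonAdditiveOfFineKato
  (hasGoodReductionAtPrime_three_of_not_dvd_conductorNorm)
open Summit.BirchSwinnertonDyer.BirchSwinnertonDyer.Theorems.KimAtThreeShallowEqDeepSplitGlueNoStub
  (shallowEqDeepAtTorsionFree_of_parts_noStub)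
open Summit.BirchSwinnertonDyer.BirchSwinnertonDyer.Theorems.KimAtThreeShallowEqDeepWeightedItems
open Summit.BirchSwinnertonDyer.BirchSwinnertonDyer.Theorems.KimAtThreeShallowEqDeepWeightedOfKatoV2
  (definedKatoWeighted_of_katoV2_of_facts)
open Summit.BirchSwinnertonDyer.BirchSwinnertonDyer.Theorems.KimAtThreeShallowEqDeepGoodOfDefinedKato
  (fineKatoτ_of_definedKatoTwist)
open Summit.BirchSwinnertonDyer.BirchSwinnertonDyer.Theorems.KimAtThreeShallowEqDeepNonAdditiveOfKatoV2
open Summit.BirchSwinnertonDyer.BirchSwinnertonDyer.Theorems.KimAtThreeShallowEqDeepKatoV2OfPosition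
open Summit.BirchSwinnertonDyer.BirchSwinnertonDyer.Theorems.KimAtThreeShallowEqDeepNonAdditiveOfPosition
open Summit.BirchSwinnertonDyer.BirchSwinnertonDyer.Theorems.KimAtThreeFineKatoPositionCrux
  (katoKuriharaPortThreeShared_of_facts_of_katoPos)
open Summit.BirchSwinnertonDyer.BirchSwinnertonDyer.Theorems.KimAtThreeDeepUpperCiteOnly
  (deepLower_and_deepUpper_of_lit_of_facts)
open Summit.BirchSwinnertonDyer.BirchSwinnertonDyer.Theorems.KimAtThreeShallowEqDeepRouteLeafOfPosition
open Summit.BirchSwinnertonDyer.BirchSwinnertonDyer.Theorems.KimAtThreeShallowEqDeepNonAdditiveOfPosition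
open Summit.BirchSwinnertonDyer.BirchSwinnertonDyer.Theorems.KimAtThreeFineKatoTwoExpFinal

namespace Summit.BirchSwinnertonDyer.BirchSwinnertonDyer.Theorems.KimAtThreeFineKatoTwoExpRouteLeaf

section OfPosition

variable (hKatoPos :
    ∀ (W : WeierstrassCurve ℚ) [W.IsElliptic] [W.IsGloballyMinimal]
        [ContinuousSMul ℤ_[3] (W.tateModule 3)] [Module.Free ℤ_[3] (W.tateModule 3)]
        [Module.Finite ℤ_[3] (W.tateModule 3)],
        (∀ m : ℕ, W.HasSurjectiveModNGaloisRep (3 ^ m : ℕ)) →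
        ∀ {N : ℕ} [NeZero N] (P : ModularParametrizationData W N), N = W.conductorNorm ℤ →
          (∀ z ∈ P.L.lattice, ∃ w ∈ periodLattice P.f, z = P.c * w) →
          haveI : Fact (((3 : ℕ) : 𝓞 ℚ) ∈ ((Rat.HeightOneSpectrum.primesEquiv (R := 𝓞 ℚ)).symm ⟨3, Fact.out⟩).asIdeal) :=
            ⟨(natCast_mem_asIdeal_iff_eq_primesEquiv_symm _ Nat.prime_three).mpr rfl⟩
          letI := valuativeRelPlace ((Rat.HeightOneSpectrum.primesEquiv (R := 𝓞 ℚ)).symm ⟨3, Fact.out⟩)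
          letI := topologicalSpacePlace ((Rat.HeightOneSpectrum.primesEquiv (R := 𝓞 ℚ)).symm ⟨3, Fact.out⟩)
          haveI := isNonarchimedeanLocalField_place ((Rat.HeightOneSpectrum.primesEquiv (R := 𝓞 ℚ)).symm ⟨3, Fact.out⟩)
          haveI := charZero_place ((Rat.HeightOneSpectrum.primesEquiv (R := 𝓞 ℚ)).symm ⟨3, Fact.out⟩)
          letI := padicAlgebraPlace 3 ((Rat.HeightOneSpectrum.primesEquiv (R := 𝓞 ℚ)).symm ⟨3, Fact.out⟩)
          haveI := fact_not_isUnit_place 3 ((Rat.HeightOneSpectrum.primesEquiv (R := 𝓞 ℚ)).symm ⟨3, Fact.out⟩)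
          haveI := isAdicComplete_place 3 ((Rat.HeightOneSpectrum.primesEquiv (R := 𝓞 ℚ)).symm ⟨3, Fact.out⟩)
          ∃ (d : LocalNeronLineAt W 3 ((Rat.HeightOneSpectrum.primesEquiv (R := 𝓞 ℚ)).symm ⟨3, Fact.out⟩)),
          ∃ (ι : (n : ℕ) → (CyclotomicField n ℚ →+* ℂ)) (κK : ℝ)
            (Λ : ∀ (k' : ℕ) (r : Finset (HeightOneSpectrum (𝓞 ℚ))),
              H1 (tateRep W 3) (cycSubgroup 3 k' r) →ₗ[ℤ_[3]]
                ℚ_[3] ⊗[ℚ] CyclotomicField (cycLevel 3 k' r) ℚ),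
            κK ≠ 0 ∧
            (∃ u : ℚ, (u : ℝ) = κK ∧
              ∀ (hinj : (bdRPeriodRingData (valuation_place_lt_one 3 ((Rat.HeightOneSpectrum.primesEquiv (R := 𝓞 ℚ)).symm ⟨3, Fact.out⟩))).CupLogInjective (logCyclotomic 3)
              (localRationalTateRep W 3 (galRestrictPlace ((Rat.HeightOneSpectrum.primesEquiv (R := 𝓞 ℚ)).symm ⟨3, Fact.out⟩))))
              (hex : ∀ z : contOneCocycles (localRationalTateRep W 3 (galRestrictPlace ((Rat.HeightOneSpectrum.primesEquiv (R := 𝓞 ℚ)).symm ⟨3, Fact.out⟩))).toTopRep,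
              (bdRPeriodRingData (valuation_place_lt_one 3 ((Rat.HeightOneSpectrum.primesEquiv (R := 𝓞 ℚ)).symm ⟨3, Fact.out⟩))).HasDualExp (logCyclotomic 3)
              (localRationalTateRep W 3 (galRestrictPlace ((Rat.HeightOneSpectrum.primesEquiv (R := 𝓞 ℚ)).symm ⟨3, Fact.out⟩))) fun σ => z.1 σ)
                (e : ((Rat.HeightOneSpectrum.primesEquiv (R := 𝓞 ℚ)).symm ⟨3, Fact.out⟩).adicCompletion ℚ) (he : e ≠ 0),
                (∀ a : ℚ_[3], (∃ y, (expStarOmegaPadicAt (d.smul e he) hinj hex (((Padic.adicCompletionEquiv (𝓞 ℚ) ⟨3, Fact.out⟩).symm : (((Rat.HeightOneSpectrum.primesEquiv (R := 𝓞 ℚ)).symm ⟨3, Fact.out⟩).adicCompletion ℚ) →+* ℚ_[3]))) y = a) ↔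
                  ∀ Q : (W.baseChange ℚ_[3]).toAffine.Point, ‖a * padicLog (W.baseChange ℚ_[3]) Q‖ ≤ 1) →
                padicValRat 3 u = ((((Padic.adicCompletionEquiv (𝓞 ℚ) ⟨3, Fact.out⟩).symm : (((Rat.HeightOneSpectrum.primesEquiv (R := 𝓞 ℚ)).symm ⟨3, Fact.out⟩).adicCompletion ℚ) →+* ℚ_[3])) e).valuation) ∧
            (∀ (j : ℕ) (r : Finset (HeightOneSpectrum (𝓞 ℚ)))
              (Ψ : ℚ_[3] ⊗[ℚ] CyclotomicField (cycLevel 3 0 r) ℚ ≃ₐ[ℚ]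
                (Π w : ((Rat.HeightOneSpectrum.primesEquiv (R := 𝓞 ℚ)).symm ⟨3, Fact.out⟩).Extension
                  (𝓞 (CyclotomicField (cycLevel 3 0 r) ℚ)), w.1.adicCompletion (CyclotomicField (cycLevel 3 0 r) ℚ)))
              (hΨ : ∀ (s : ℚ_[3]) (x : CyclotomicField (cycLevel 3 0 r) ℚ)
                (w : ((Rat.HeightOneSpectrum.primesEquiv (R := 𝓞 ℚ)).symm ⟨3, Fact.out⟩).Extension
                  (𝓞 (CyclotomicField (cycLevel 3 0 r) ℚ))),
                Ψ (s ⊗ₜ[ℚ] x) w =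
                  algebraMap (CyclotomicField (cycLevel 3 0 r) ℚ) (w.1.adicCompletion (CyclotomicField (cycLevel 3 0 r) ℚ)) x *
                  algebraMap (((Rat.HeightOneSpectrum.primesEquiv (R := 𝓞 ℚ)).symm ⟨3, Fact.out⟩).adicCompletion ℚ)
                    (w.1.adicCompletion (CyclotomicField (cycLevel 3 0 r) ℚ)) ((Padic.adicCompletionEquiv (𝓞 ℚ) ⟨3, Fact.out⟩) s)),
              ∃ (w₀ : ((Rat.HeightOneSpectrum.primesEquiv (R := 𝓞 ℚ)).symm ⟨3, Fact.out⟩).Extension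
                  (𝓞 (CyclotomicField (cycLevel 3 0 r) ℚ)))
                (g : ((Rat.HeightOneSpectrum.primesEquiv (R := 𝓞 ℚ)).symm ⟨3, Fact.out⟩).Extension
                  (𝓞 (CyclotomicField (cycLevel 3 0 r) ℚ)) → absoluteGaloisGroup ℚ)
                (hg : ∀ w : ((Rat.HeightOneSpectrum.primesEquiv (R := 𝓞 ℚ)).symm ⟨3, Fact.out⟩).Extension
                  (𝓞 (CyclotomicField (cycLevel 3 0 r) ℚ)),
                  sigma (cycLevel 3 0 r) (modNCyclotomicCharacter ℚ (cycLevel 3 0 r) (g w)) • w.1 = w₀.1),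
                  letI := LocalField.charZero_adicCompletion w₀.1
                  letI := LocalField.adicCompletionPadicAlgebra w₀.1 3 (three_mem_asIdeal_extension _ w₀)
                  haveI : Fact (¬ IsUnit ((3 : ℕ) : integerC (w₀.1.adicCompletion (CyclotomicField (cycLevel 3 0 r) ℚ)))) :=
                    ⟨not_isUnit_natCast_integerC (LocalField.valuation_adicCompletion_natCast_lt_one w₀.1 3 (three_mem_asIdeal_extension _ w₀))⟩
                  haveI := isAdicComplete_integerC_natCast (LocalField.valuation_adicCompletion_natCast_lt_one w₀.1 3 (three_mem_asIdeal_extension _ w₀))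
                  ∃ (dw : LocalNeronLine W (LocalField.valuation_adicCompletion_natCast_lt_one w₀.1 3 (three_mem_asIdeal_extension _ w₀))
                    ((galRestrictPlace ((Rat.HeightOneSpectrum.primesEquiv (R := 𝓞 ℚ)).symm ⟨3, Fact.out⟩)).comp
                      (absGaloisRestrict (((Rat.HeightOneSpectrum.primesEquiv (R := 𝓞 ℚ)).symm ⟨3, Fact.out⟩).adicCompletion ℚ) (w₀.1.adicCompletion (CyclotomicField (cycLevel 3 0 r) ℚ)))))
                    (hinjw : (bdRPeriodRingData (LocalField.valuation_adicCompletion_natCast_lt_one w₀.1 3 (three_mem_asIdeal_extension _ w₀))).CupLogInjective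
                    (logCyclotomic 3) (localRationalTateRep W 3 ((galRestrictPlace ((Rat.HeightOneSpectrum.primesEquiv (R := 𝓞 ℚ)).symm ⟨3, Fact.out⟩)).comp
                      (absGaloisRestrict (((Rat.HeightOneSpectrum.primesEquiv (R := 𝓞 ℚ)).symm ⟨3, Fact.out⟩).adicCompletion ℚ) (w₀.1.adicCompletion (CyclotomicField (cycLevel 3 0 r) ℚ))))))
                    (hexw : ∀ z : contOneCocycles (localRationalTateRep W 3 ((galRestrictPlace ((Rat.HeightOneSpectrum.primesEquiv (R := 𝓞 ℚ)).symm ⟨3, Fact.out⟩)).comp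
                      (absGaloisRestrict (((Rat.HeightOneSpectrum.primesEquiv (R := 𝓞 ℚ)).symm ⟨3, Fact.out⟩).adicCompletion ℚ) (w₀.1.adicCompletion (CyclotomicField (cycLevel 3 0 r) ℚ))))).toTopRep,
                    (bdRPeriodRingData (LocalField.valuation_adicCompletion_natCast_lt_one w₀.1 3 (three_mem_asIdeal_extension _ w₀))).HasDualExp
                      (logCyclotomic 3) (localRationalTateRep W 3 ((galRestrictPlace ((Rat.HeightOneSpectrum.primesEquiv (R := 𝓞 ℚ)).symm ⟨3, Fact.out⟩)).comp
                      (absGaloisRestrict (((Rat.HeightOneSpectrum.primesEquiv (R := 𝓞 ℚ)).symm ⟨3, Fact.out⟩).adicCompletion ℚ) (w₀.1.adicCompletion (CyclotomicField (cycLevel 3 0 r) ℚ))))) fun σ => z.1 σ),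
                    (∀ (h : (tateLocalRep W 3 (Sum.inr ((Rat.HeightOneSpectrum.primesEquiv (R := 𝓞 ℚ)).symm ⟨3, Fact.out⟩))).cohomology 1),
                    (expStarOmegaHom (LocalField.valuation_adicCompletion_natCast_lt_one w₀.1 3 (three_mem_asIdeal_extension _ w₀))
                      ((galRestrictPlace ((Rat.HeightOneSpectrum.primesEquiv (R := 𝓞 ℚ)).symm ⟨3, Fact.out⟩)).comp
                      (absGaloisRestrict (((Rat.HeightOneSpectrum.primesEquiv (R := 𝓞 ℚ)).symm ⟨3, Fact.out⟩).adicCompletion ℚ) (w₀.1.adicCompletion (CyclotomicField (cycLevel 3 0 r) ℚ)))) dw hinjw hexw)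
                      (ContinuousRep.cohomologyRes (tateLocalRep W 3 (Sum.inr ((Rat.HeightOneSpectrum.primesEquiv (R := 𝓞 ℚ)).symm ⟨3, Fact.out⟩)))
                        (absGaloisRestrict (((Rat.HeightOneSpectrum.primesEquiv (R := 𝓞 ℚ)).symm ⟨3, Fact.out⟩).adicCompletion ℚ) (w₀.1.adicCompletion (CyclotomicField (cycLevel 3 0 r) ℚ))) 1 h) =
                    algebraMap (((Rat.HeightOneSpectrum.primesEquiv (R := 𝓞 ℚ)).symm ⟨3, Fact.out⟩).adicCompletion ℚ) (w₀.1.adicCompletion (CyclotomicField (cycLevel 3 0 r) ℚ)) (expStarOmegaAt d h)) ∧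
                    (∀ (w : ((Rat.HeightOneSpectrum.primesEquiv (R := 𝓞 ℚ)).symm ⟨3, Fact.out⟩).Extension
                      (𝓞 (CyclotomicField (cycLevel 3 0 r) ℚ)))
                    (y : H1 (tateRep W 3) (cycSubgroup 3 0 r))
                    (φ'' : contOneCocycles (subgroupRep (tateRep W 3).toTopRep (cycSubgroup 3 0 r)))
                    (ψT : contOneCocycles ((tateLocalRep W 3 (Sum.inr ((Rat.HeightOneSpectrum.primesEquiv (R := 𝓞 ℚ)).symm ⟨3, Fact.out⟩))).restrict
                      (absGaloisRestrict (((Rat.HeightOneSpectrum.primesEquiv (R := 𝓞 ℚ)).symm ⟨3, Fact.out⟩).adicCompletion ℚ) (w₀.1.adicCompletion (CyclotomicField (cycLevel 3 0 r) ℚ)))).toTopRep),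
                    oneCocycleClass _ φ'' = conjMap (tateRep W 3).toTopRep (cycSubgroup 3 0 r) (g w) 1 y →
                    (∀ σ, ψT.1 σ = φ''.1 ⟨absGaloisRestrictTower ℚ (((Rat.HeightOneSpectrum.primesEquiv (R := 𝓞 ℚ)).symm ⟨3, Fact.out⟩).adicCompletion ℚ) (w₀.1.adicCompletion (CyclotomicField (cycLevel 3 0 r) ℚ)) σ,
                      absGaloisRestrictTower_adicCompletion_mem_cycSubgroup r w₀ σ⟩) →
                    Ψ (Λ 0 r y) w = galAdicCompletionMap
                      (sigma (cycLevel 3 0 r) (modNCyclotomicCharacter ℚ (cycLevel 3 0 r) (g w)))⁻¹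
                      (inv_smul_eq_of_smul_eq (hg w))
                      ((expStarOmegaHom (LocalField.valuation_adicCompletion_natCast_lt_one w₀.1 3 (three_mem_asIdeal_extension _ w₀))
                      ((galRestrictPlace ((Rat.HeightOneSpectrum.primesEquiv (R := 𝓞 ℚ)).symm ⟨3, Fact.out⟩)).comp
                      (absGaloisRestrict (((Rat.HeightOneSpectrum.primesEquiv (R := 𝓞 ℚ)).symm ⟨3, Fact.out⟩).adicCompletion ℚ) (w₀.1.adicCompletion (CyclotomicField (cycLevel 3 0 r) ℚ)))) dw hinjw hexw) (oneCocycleClass _ ψT)))) ∧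
            ∀ (c d a : ℤ) (A : ℕ), 0 < A → Int.gcd c (6 * 3 * A) = 1 → Int.gcd d (6 * 3 * N) = 1 →
              ∃ (z : ∀ (k' : ℕ) (r : (cyclotomicLevelsRat 3 (badPlaces c d A N)).Ideals),
                    H1 (tateRep W 3) ((cyclotomicLevelsRat 3 (badPlaces c d A N)).level k' r.1))
                (x : ∀ (k' : ℕ) (r : (cyclotomicLevelsRat 3 (badPlaces c d A N)).Ideals),
                    CyclotomicField (cycLevel 3 k' r.1) ℚ),
                ZetaBody W 3 P.f ι κK Λ c d a A z x)
include hKatoPos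

set_option maxHeartbeats 800000 in
/-- **Crux 19599 `ShallowEqDeepOffKatoStratum` BY NAME ⟸ the three route leaves ∧ {(S5a), (S5b-tower), (P123), (DR)} ∧ hKatoPosʷ** —
w2-c4's `shallowEqDeepOffKatoStratum_of_katoPos_of_facts` with (S5b) := kim3's `exists_smul_range_expStarCoord_iff_trace_log_of_tower hT₂`
and item 20398 := this seat's `fineKatoTwoExpDefectThree_of_facts_of_katoPosW`.  CONDITIONAL; nothing booked; 19599 stays OPEN.
[cite: Kim2025RefinedTNC, Thm 1.2] [cite: Sakamoto2024, Thm. 4.4 (p. 926)] [cite: MazurRubin2004, Thm. 4.4.1 and Thm. 5.2.12]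
[cite: Kato2004Asterisque, (8.1.3) (p. 180), Prop. 8.12 (p. 186), §9.4 and Thm. 9.7 (pp. 188–189), Thm. 6.6 (1) (p. 163), Ex. 13.3 (pp. 224–225)]
[cite: Kato1993LNM1553, Ch. II §1.2.4, Prop. 1.2.3 and Thm. 1.4.1] [cite: BlochKato1990, §3 Prop. 3.8, Ex. 3.11] -/
theorem shallowEqDeepOffKatoStratum_of_katoPos_of_cites'
    (hSak : SakamotoKolyvaginThree) (hGZK : RankEqAnalyticRankLeOne) (hPT : PoitouTateSelmerDuality)
    (hP : cupLogInjective_and_hasDualExp_of_isDeRham) (hDR : isDeRham_restrictedRationalTateRep)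
    (hS : expStarCoord_eq_zero_iff_kummer) (hT₂ : exists_smul_range_expStarCoord_tower_iff_trace_log) :
    ShallowEqDeepOffKatoStratum :=
  shallowEqDeepOffKatoStratum_of_katoPos_of_facts hKatoPos hSak hGZK hPT hP hDR
    (exists_smul_range_expStarCoord_iff_trace_log_of_tower hT₂) hS hT₂
    (fineKatoTwoExpDefectThree_of_facts_of_katoPosW hS hT₂ hP hDR hKatoPos)

set_option maxHeartbeats 800000 in
/-- **Crux 19077 `ShallowEqDeepAtTorsionFree` BY NAME ⟸ the four route leaves ∧ {(S5a), (S5b-tower), (P123), (DR)} ∧ hKatoPosʷ** —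
w2-c4's `shallowEqDeepAtTorsionFree_of_katoPos_of_four_cites` with item 20398 := `fineKatoTwoExpDefectThree_of_facts_of_katoPosW`.
CONDITIONAL; nothing booked; 19077 stays OPEN.
[cite: Kim2025RefinedTNC, Thm 1.2] [cite: Sakamoto2024, Thm. 4.4 (p. 926)] [cite: MazurRubin2004, Thm. 4.4.1 and Thm. 5.2.12]
[cite: Kato2004Asterisque, (8.1.3) (p. 180), Prop. 8.12 (p. 186), §9.4 and Thm. 9.7 (pp. 188–189), Thm. 6.6 (1) (p. 163), Ex. 13.3 (pp. 224–225)]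
[cite: Kato1993LNM1553, Ch. II §1.2.4, Prop. 1.2.3 and Thm. 1.4.1] [cite: BlochKato1990, §3 Prop. 3.8, Ex. 3.11] [cite: Carayol1986] -/
theorem shallowEqDeepAtTorsionFree_of_katoPos_of_cites'
    (hSak : SakamotoKolyvaginThree) (hGZK : RankEqAnalyticRankLeOne) (hPT : PoitouTateSelmerDuality)
    (hlev : CarayolLevelEqConductor)
    (hP : cupLogInjective_and_hasDualExp_of_isDeRham) (hDR : isDeRham_restrictedRationalTateRep)
    (hS : expStarCoord_eq_zero_iff_kummer) (hT₂ : exists_smul_range_expStarCoord_tower_iff_trace_log) :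
    ShallowEqDeepAtTorsionFree :=
  shallowEqDeepAtTorsionFree_of_katoPos_of_four_cites hKatoPos hSak hGZK hPT hlev hP hDR hS hT₂
    (fineKatoTwoExpDefectThree_of_facts_of_katoPosW hS hT₂ hP hDR hKatoPos)

set_option maxHeartbeats 800000 in
/-- **The ROUTE LEAF `N11.KimAtThreeRankZeroPUB` BY NAME ⟸ the four route leaves ∧ {(S5a), (S5b-tower), (P123), (DR)} ∧ the Kato
Literature fact `Kato2004.exists_eulerSystem_definedExpStar_values` ∧ hKatoPosʷ** — w2-c4's
`kimAtThreeRankZeroPUB_of_katoPos_of_lit_of_four_cites` with item 20398 := `fineKatoTwoExpDefectThree_of_facts_of_katoPosW`.  CONDITIONAL on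
every displayed hypothesis; closes the rung-W2 leaf only modulo them; BSD is NOT proved by this.
[cite: Kim2025RefinedTNC, Thm 1.1, Thm 1.2] [cite: Kato2004Asterisque, (8.1.3) (p. 180), Prop. 8.12 (p. 186), §9.4 and Thm. 9.7 (pp. 188–189), Thm. 6.6 (1) (p. 163), Ex. 13.3 (pp. 224–225)]
[cite: Kato1993LNM1553, Ch. II §1.2.4, Prop. 1.2.3 and Thm. 1.4.1] [cite: BlochKato1990, §3 Prop. 3.8, Ex. 3.11]
[cite: Sakamoto2024, Thm. 4.4 (p. 926)] [cite: MazurRubin2004, Thm. 4.4.1 and Thm. 5.2.12] [cite: Carayol1986] -/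
theorem kimAtThreeRankZeroPUB_of_katoPos_of_lit_of_cites'
    (hLit : Kato2004.exists_eulerSystem_definedExpStar_values)
    (hSak : SakamotoKolyvaginThree) (hGZK : RankEqAnalyticRankLeOne) (hPT : PoitouTateSelmerDuality)
    (hlev : CarayolLevelEqConductor)
    (hP : cupLogInjective_and_hasDualExp_of_isDeRham) (hDR : isDeRham_restrictedRationalTateRep)
    (hS : expStarCoord_eq_zero_iff_kummer) (hT₂ : exists_smul_range_expStarCoord_tower_iff_trace_log) :
    Summit.BirchSwinnertonDyer.Rank1Residual.Additive.N11.KimAtThreeRankZeroPUB :=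
  kimAtThreeRankZeroPUB_of_katoPos_of_lit_of_four_cites hKatoPos hLit hSak hGZK hPT hlev hP hDR hS hT₂
    (fineKatoTwoExpDefectThree_of_facts_of_katoPosW hS hT₂ hP hDR hKatoPos)

end OfPosition

/-! ### §2. The same end forms on the NAMED statement `KimAtThreeShallowEqDeepPositionDefs.KatoPeriodPositionAtThree` (w2-c4 gen 13) -/

section OfPeriodPosition

open Summit.BirchSwinnertonDyer.BirchSwinnertonDyer.Theorems.KimAtThreeShallowEqDeepOfPeriodPosition

/-- **Item 20398 `FineKatoTwoExpDefectThree` BY NAME ⟸ {(S5a), (S5b-tower), (P123), (DR)} ∧ `KatoPeriodPositionAtThree`** — every hypothesis a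
named one-liner: `fineKatoTwoExpDefectThree_of_facts_of_katoPosW` at w2-c4 gen 13's `katoPosW_of_periodPosition_of_facts`.  CONDITIONAL (four
cite facts + the route's own displayed position statement, PRE/STRONGER than Kato's theorem — w2-c4's framing); nothing booked; 20398 stays OPEN.
[cite: Kato2004Asterisque, (8.1.3) (p. 180), Prop. 8.12 (p. 186), §9.4 and Thm. 9.7 (pp. 188–189), Thm. 6.6 (1) (p. 163), Ex. 13.3 (pp. 224–225)]
[cite: Kato1993LNM1553, Ch. II §1.2.4, Prop. 1.2.3 and Thm. 1.4.1] [cite: BlochKato1990, §3 Prop. 3.8, Ex. 3.11]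
[cite: Kim2022StructureSelmer, §3.2.3, Lemma 3.10, §3.3–§3.4.1 and Thm. 3.13] -/
theorem fineKatoTwoExpDefectThree_of_periodPosition_of_cites
    (hPos : KimAtThreeShallowEqDeepPositionDefs.KatoPeriodPositionAtThree)
    (hP : cupLogInjective_and_hasDualExp_of_isDeRham) (hDR : isDeRham_restrictedRationalTateRep)
    (hS : expStarCoord_eq_zero_iff_kummer) (hT₂ : exists_smul_range_expStarCoord_tower_iff_trace_log) :
    FineKatoTwoExpDefectThree :=
  fineKatoTwoExpDefectThree_of_facts_of_katoPosW hS hT₂ hP hDR (katoPosW_of_periodPosition_of_facts hP hDR hPos)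

/-- **Crux 19599 `ShallowEqDeepOffKatoStratum` BY NAME ⟸ the three route leaves ∧ {(S5a), (S5b-tower), (P123), (DR)} ∧
`KatoPeriodPositionAtThree`** (w2-c4's `shallowEqDeepOffKatoStratum_of_periodPosition_of_cites` with item 20398 := the theorem above).
CONDITIONAL; nothing booked; 19599 stays OPEN.
[cite: Kim2025RefinedTNC, Thm 1.2] [cite: Sakamoto2024, Thm. 4.4 (p. 926)] [cite: MazurRubin2004, Thm. 4.4.1 and Thm. 5.2.12]
[cite: Kato2004Asterisque, (8.1.3) (p. 180), Prop. 8.12 (p. 186), §9.4 and Thm. 9.7 (pp. 188–189), Thm. 6.6 (1) (p. 163), Ex. 13.3 (pp. 224–225)]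
[cite: Kato1993LNM1553, Ch. II §1.2.4, Prop. 1.2.3 and Thm. 1.4.1] [cite: BlochKato1990, §3 Prop. 3.8, Ex. 3.11] -/
theorem shallowEqDeepOffKatoStratum_of_periodPosition_of_cites'
    (hPos : KimAtThreeShallowEqDeepPositionDefs.KatoPeriodPositionAtThree)
    (hSak : SakamotoKolyvaginThree) (hGZK : RankEqAnalyticRankLeOne) (hPT : PoitouTateSelmerDuality)
    (hP : cupLogInjective_and_hasDualExp_of_isDeRham) (hDR : isDeRham_restrictedRationalTateRep)
    (hS : expStarCoord_eq_zero_iff_kummer) (hT₂ : exists_smul_range_expStarCoord_tower_iff_trace_log) :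
    ShallowEqDeepOffKatoStratum :=
  shallowEqDeepOffKatoStratum_of_periodPosition_of_cites hPos hSak hGZK hPT hP hDR hS hT₂
    (fineKatoTwoExpDefectThree_of_periodPosition_of_cites hPos hP hDR hS hT₂)

/-- **Crux 19077 `ShallowEqDeepAtTorsionFree` BY NAME ⟸ the four route leaves ∧ {(S5a), (S5b-tower), (P123), (DR)} ∧
`KatoPeriodPositionAtThree`** (w2-c4's `shallowEqDeepAtTorsionFree_of_periodPosition_of_cites` with item 20398 := the theorem above).
CONDITIONAL; nothing booked; 19077 stays OPEN.
[cite: Kim2025RefinedTNC, Thm 1.2] [cite: Sakamoto2024, Thm. 4.4 (p. 926)] [cite: MazurRubin2004, Thm. 4.4.1 and Thm. 5.2.12]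
[cite: Kato2004Asterisque, (8.1.3) (p. 180), Prop. 8.12 (p. 186), §9.4 and Thm. 9.7 (pp. 188–189), Thm. 6.6 (1) (p. 163), Ex. 13.3 (pp. 224–225)]
[cite: Kato1993LNM1553, Ch. II §1.2.4, Prop. 1.2.3 and Thm. 1.4.1] [cite: BlochKato1990, §3 Prop. 3.8, Ex. 3.11] [cite: Carayol1986] -/
theorem shallowEqDeepAtTorsionFree_of_periodPosition_of_cites'
    (hPos : KimAtThreeShallowEqDeepPositionDefs.KatoPeriodPositionAtThree)
    (hSak : SakamotoKolyvaginThree) (hGZK : RankEqAnalyticRankLeOne) (hPT : PoitouTateSelmerDuality)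
    (hlev : CarayolLevelEqConductor)
    (hP : cupLogInjective_and_hasDualExp_of_isDeRham) (hDR : isDeRham_restrictedRationalTateRep)
    (hS : expStarCoord_eq_zero_iff_kummer) (hT₂ : exists_smul_range_expStarCoord_tower_iff_trace_log) :
    ShallowEqDeepAtTorsionFree :=
  shallowEqDeepAtTorsionFree_of_periodPosition_of_cites hPos hSak hGZK hPT hlev hP hDR hS hT₂
    (fineKatoTwoExpDefectThree_of_periodPosition_of_cites hPos hP hDR hS hT₂)

/-- **The W2 ROUTE LEAF `N11.KimAtThreeRankZeroPUB` BY NAME ⟸ the four route leaves ∧ {(S5a), (S5b-tower), (P123), (DR)} ∧ the Kato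
Literature fact `Kato2004.exists_eulerSystem_definedExpStar_values` ∧ `KatoPeriodPositionAtThree`** — EVERY hypothesis a named one-liner,
item 20398 GONE (w2-c4's `kimAtThreeRankZeroPUB_of_periodPosition_of_lit_of_cites` with item 20398 := the theorem above).  CONDITIONAL on every
displayed hypothesis; closes the rung-W2 leaf only modulo them; BSD is NOT proved by this.
[cite: Kim2025RefinedTNC, Thm 1.1, Thm 1.2] [cite: Kato2004Asterisque, (8.1.3) (p. 180), Prop. 8.12 (p. 186), §9.4 and Thm. 9.7 (pp. 188–189), Thm. 6.6 (1) (p. 163), Ex. 13.3 (pp. 224–225)]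
[cite: Kato1993LNM1553, Ch. II §1.2.4, Prop. 1.2.3 and Thm. 1.4.1] [cite: BlochKato1990, §3 Prop. 3.8, Ex. 3.11]
[cite: Sakamoto2024, Thm. 4.4 (p. 926)] [cite: MazurRubin2004, Thm. 4.4.1 and Thm. 5.2.12] [cite: Carayol1986] -/
theorem kimAtThreeRankZeroPUB_of_periodPosition_of_lit_of_cites'
    (hPos : KimAtThreeShallowEqDeepPositionDefs.KatoPeriodPositionAtThree)
    (hLit : Kato2004.exists_eulerSystem_definedExpStar_values)
    (hSak : SakamotoKolyvaginThree) (hGZK : RankEqAnalyticRankLeOne) (hPT : PoitouTateSelmerDuality)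
    (hlev : CarayolLevelEqConductor)
    (hP : cupLogInjective_and_hasDualExp_of_isDeRham) (hDR : isDeRham_restrictedRationalTateRep)
    (hS : expStarCoord_eq_zero_iff_kummer) (hT₂ : exists_smul_range_expStarCoord_tower_iff_trace_log) :
    Summit.BirchSwinnertonDyer.Rank1Residual.Additive.N11.KimAtThreeRankZeroPUB :=
  kimAtThreeRankZeroPUB_of_periodPosition_of_lit_of_cites hPos hLit hSak hGZK hPT hlev hP hDR hS hT₂
    (fineKatoTwoExpDefectThree_of_periodPosition_of_cites hPos hP hDR hS hT₂)

end OfPeriodPosition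

end Summit.BirchSwinnertonDyer.BirchSwinnertonDyer.Theorems.KimAtThreeFineKatoTwoExpRouteLeaf

end
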